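import Mathlib.Algebra.Polynomial.Reverse
import Literature.NumberTheory.Transcendental.SemialgebraicMapsProofs
import Literature.NumberTheory.Transcendental.SemialgebraicAlgebraicPoints
import Summits.KontsevichZagierPeriods.KontsevichZagierPeriods.Theorems.HermiteRigidityGenusTwoCycleTransferPushforwardDimOne
import Summits.KontsevichZagierPeriods.KontsevichZagierPeriods.Theorems.AbelContractionRealHyperellipticSectorDefs
import Summits.KontsevichZagierPeriods.KontsevichZagierPeriods.Theorems.AbelContractionRealHyperellipticSectorBakerPieces
import Summits.KontsevichZagierPeriods.KontsevichZagierPeriods.Theorems.AbelContractionRealHyperellipticSectorPortBoxRigidityDimOne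

/-!
# Route AbelContraction — `RealHyperellipticSector` (crux stmt-KontsevichZagierPeriods-12475):
# the Baker sector, II — registered stub `stub_bakerAlg`

Proof file of the line `Lines/birth.lean` (`--supports` the crux): the registered stub
`stub_bakerAlg` — every value-`0` element of the subgroup of `KZ.FormalRep` generated by the
real-algebraic rational arcs `algArcs` (`[S, P/Q]`, `S ⊆ ℝ` an open interval possibly unbounded,
`P, Q ∈ K[X]`, `K = algebraicClosure ℚ ℝ`, `Q ≠ 0` on the domain) and the `0`-dimensional
representations `consts` lies in the TRUNCATED relations `KZ.relationsLE 1`. Every class involved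
is a mixed normal form `[pt, r] + Σ Λ(uⱼ, cⱼ) + Σ T(t_l, d_l)` in `FormalRep ⧸ relationsLE 1`:

* `nfD_of_kRational_invert` — a piece of an arc far from `0` (`|x| > 1` on the domain) is carried by
  ONE rule-(2) move of dimension `1`, `y = 1/x` (the route constructor `stub_pushforwardDimOne`),
  to a BOUNDED piece whose integrand `P(1/y)/(Q(1/y) y²)` is again `K`-rational
  (`Polynomial.reflect`), hence a mixed normal form (`Baker.nfD_of_kRational_bounded`);
* `nfD_of_kRational_dim_one` — split an arc at `x = ±1` (rule 1a in dimension `1`,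
  `Budget.split_mem_relationsLE`): a bounded middle piece and two far pieces;
* `nfD_of_dim_zero` — a `0`-dimensional representation is empty (a truncated relation) or a point
  with real algebraic value (`IsSemialgebraicFunOn.isAlgebraic_apply`), a mixed normal form;
* closure under `+`, `−` (`Port.Dlog.nfD_add`, `Port.Dlog.nfD_neg`), and Baker inside the budget
  (`Port.Dlog.nfD_eq_zero_of_eval_eq_zero`): a value-`0` mixed normal form is the zero class.

Together with `stub_euler` and `stub_cells` this is the genus-`0` (Baker) sector of the crux, and
the kernel form of `BakerSectorDimOne` (route DimensionBudget) for real-algebraic rational arcs.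

References: M. Kontsevich, D. Zagier, *Periods* (2001), §1.2 rules (1)–(3), Conjecture 1
[KontsevichZagier2001]; A. Baker, *Transcendental Number Theory* (1975), Thm. 2.1 [Baker1975].
No definitions are introduced.
-/

noncomputable section

open MeasureTheory Set
open scoped Polynomial
open Literature.NumberTheory.Transcendental Literature.NumberTheory.Transcendental.KZ
open Literature.ModelTheory.ExponentialFields (IsSemialgebraic)

namespace Summit.KontsevichZagierPeriods.AbelContraction.RealHyperellipticSector

namespace Baker

open Summit.KontsevichZagierPeriods.HermiteRigidity.GenusTwoCycleTransfer (stub_pushforwardDimOne)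
open Summit.KontsevichZagierPeriods.HurwitzMicroSectors.NormalFormPrinciple.PiBox.Dlog
  (exists_carrierA exists_ptCarrierA exists_angCarrier)
open Summit.KontsevichZagierPeriods.AbelContraction.RealHyperellipticSector.Port.Dlog
  (nfD_zero nfD_add nfD_neg nfD_pt nfD_eq_zero_of_eval_eq_zero)

variable {RA : ℝ → ℝ → ℝ → IntegralRep 1} {ZA : ℝ → IntegralRep 0} {RG : ℝ → ℝ → IntegralRep 1}

/-! ## Evaluating a `K`-polynomial at `1/y` -/

/-- `P(1/y) = (reflect N P)(y) · y^{−N}` for `y ≠ 0`, `deg P ≤ N` (coefficients in `K`, values in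
`ℝ`). [folklore] -/
theorem aevalK_inv_eq (P : (algebraicClosure ℚ ℝ)[X]) {N : ℕ} (hP : P.natDegree ≤ N) {y : ℝ}
    (hy : y ≠ 0) :
    (Polynomial.aeval y⁻¹ P : ℝ) = Polynomial.aeval y (Polynomial.reflect N P) * y⁻¹ ^ N := by
  haveI : Invertible (y⁻¹ : ℝ) := invertibleOfNonzero (inv_ne_zero hy)
  have h := Polynomial.eval₂_reflect_mul_pow (algebraMap (algebraicClosure ℚ ℝ) ℝ) y⁻¹ N P hP
  rw [invOf_eq_inv, inv_inv] at h
  rw [Polynomial.aeval_def, Polynomial.aeval_def, ← h]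

/-! ## The inversion move: a far piece of an arc is a bounded `K`-rational piece -/

/-- **The inversion move** (inside the budget `relationsLE 1`). Let `N` be a representation of
dimension one with `|x₀| > 1` on its domain and integrand `P/Q` there (`P, Q ∈ K[X]`, `Q ≠ 0` on
the domain). The chart `y = 1/x` is ONE rule-(2) move among representations of dimension `1`
(`stub_pushforwardDimOne`, derivative `−1/x² ≠ 0`, inverse `x = 1/y`) onto a representation with
domain inside `(−1, 1)` and integrand `P(1/y)/(Q(1/y) y²) = (reflect P)(y) y^{deg Q} /
((reflect Q)(y) y^{deg P + 2})`, again `K`-rational and pole-free on its domain; hence the class of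
`N` is a mixed normal form (`Baker.nfD_of_kRational_bounded`). [cite: KontsevichZagier2001, §1.2 rule (2)] -/
theorem nfD_of_kRational_invert
    (hR : ∀ a b c, IsAlgebraic ℚ a → IsAlgebraic ℚ b → IsAlgebraic ℚ c → 0 < a →
      (RA a b c).domain = {x | x 0 ∈ Set.Ioo a b} ∧ (RA a b c).integrand = fun x => c / x 0)
    (hZ : ∀ r, IsAlgebraic ℚ r → (ZA r).domain = univ ∧ (ZA r).integrand = fun _ => r)
    (hRG : ∀ t d, IsAlgebraic ℚ t → IsAlgebraic ℚ d →
      (RG t d).domain = {x | x 0 ∈ Set.Ioo 0 t} ∧ (RG t d).integrand = fun x => d / (1 + x 0 ^ 2))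
    (N : IntegralRep 1) (hfar : ∀ p ∈ N.domain, 1 < |p 0|) (P Q : (algebraicClosure ℚ ℝ)[X])
    (hQ : ∀ p ∈ N.domain, (Polynomial.aeval (p 0) Q : ℝ) ≠ 0)
    (hNi : EqOn N.integrand (fun x => (Polynomial.aeval (x 0) P : ℝ) / Polynomial.aeval (x 0) Q)
      N.domain) :
    ∃ (r : ℝ) (k : ℕ) (u c : Fin k → ℝ) (k' : ℕ) (t d : Fin k' → ℝ), IsAlgebraic ℚ r ∧ (∀ j, 1 < u j) ∧
      (∀ j, IsAlgebraic ℚ (u j)) ∧ (∀ j, IsAlgebraic ℚ (c j)) ∧ (∀ l, 0 ≤ t l) ∧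
      (∀ l, IsAlgebraic ℚ (t l)) ∧ (∀ l, IsAlgebraic ℚ (d l)) ∧
      QuotientAddGroup.mk' (relationsLE 1) (of N) = QuotientAddGroup.mk' (relationsLE 1) (of (ZA r)) +
        ∑ j, QuotientAddGroup.mk' (relationsLE 1) (of (RA 1 (u j) (c j))) +
        ∑ l, QuotientAddGroup.mk' (relationsLE 1) (of (RG (t l) (d l))) := by
  have hσ := N.isSemialgebraic_domain
  have h0 : ∀ p ∈ N.domain, p 0 ≠ 0 := fun p hp h => by
    have := hfar p hp; rw [h, abs_zero] at this; exact absurd this (by norm_num)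
  -- the chart `φ x = 1/x`, its derivative and inverse
  set φ : ℝ → ℝ := fun x => x⁻¹ with hφ
  set φ' : ℝ → ℝ := fun x => -(x ^ 2)⁻¹ with hφ'
  set G : (Fin 1 → ℝ) → (Fin 1 → ℝ) := fun w => fun _ => (w 0)⁻¹ with hG
  have hφsa : IsSemialgebraicFunOn ℚ N.domain (fun p => φ (p 0)) := by
    refine (isSemialgebraicFunOn_aeval_div_aeval hσ (1 : MvPolynomial (Fin 1) ℚ) (MvPolynomial.X 0)
      fun x hx => ?_).congr fun x _ => ?_
    · simpa using h0 x hx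
    · simp [hφ]
  have hφ'sa : IsSemialgebraicFunOn ℚ N.domain (fun p => φ' (p 0)) := by
    refine (isSemialgebraicFunOn_aeval_div_aeval hσ (MvPolynomial.C (-1) : MvPolynomial (Fin 1) ℚ)
      (MvPolynomial.X 0 ^ 2) fun x hx => ?_).congr fun x _ => ?_
    · simpa using h0 x hx
    · simp [hφ', div_eq_mul_inv]
  have hder : ∀ p ∈ N.domain, HasDerivAt φ (φ' (p 0)) (p 0) := fun p hp => hasDerivAt_inv (h0 p hp)
  have hne : ∀ p ∈ N.domain, φ' (p 0) ≠ 0 := fun p hp => by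
    simp only [hφ']
    exact neg_ne_zero.mpr (inv_ne_zero (pow_ne_zero 2 (h0 p hp)))
  -- the image and the inverse chart on it
  have hΦsa : IsSemialgebraicMapOn ℚ N.domain (fun p : Fin 1 → ℝ => fun _ : Fin 1 => φ (p 0)) :=
    IsSemialgebraicMapOn.of_forall hσ fun _ => hφsa
  have himgsa : IsSemialgebraic ℚ ((fun p : Fin 1 → ℝ => fun _ : Fin 1 => φ (p 0)) '' N.domain) :=
    IsSemialgebraicMapOn.isSemialgebraic_image_holds hΦsa subset_rfl hσ
  have himg0 : ∀ w ∈ (fun p : Fin 1 → ℝ => fun _ : Fin 1 => φ (p 0)) '' N.domain, w 0 ≠ 0 := by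
    rintro _ ⟨p, hp, rfl⟩
    exact inv_ne_zero (h0 p hp)
  have hGsa : IsSemialgebraicMapOn ℚ ((fun p : Fin 1 → ℝ => fun _ : Fin 1 => φ (p 0)) '' N.domain) G := by
    refine IsSemialgebraicMapOn.of_forall himgsa fun j => ?_
    refine (isSemialgebraicFunOn_aeval_div_aeval himgsa (1 : MvPolynomial (Fin 1) ℚ)
      (MvPolynomial.X 0) fun w hw => ?_).congr fun w _ => ?_
    · simpa using himg0 w hw
    · simp [hG]
  have hGφ : ∀ p ∈ N.domain, G (fun _ => φ (p 0)) = p := by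
    intro p _
    funext i
    rw [Fin.fin_one_eq_zero i]
    simp [hG, hφ]
  -- push forward (ONE change of variables between representations of dimension `1`)
  obtain ⟨s, hsd, hsi, hmove⟩ := stub_pushforwardDimOne N φ φ' G hφsa hφ'sa hder hne hGsa hGφ
  have h1 : of N - of s ∈ relationsLE 1 :=
    movesLE_subset_relationsLE 1
      ⟨Or.inl (Or.inr hmove), sub_mem (of_mem_formalRepLE N le_rfl) (of_mem_formalRepLE s le_rfl)⟩
  have hcls : QuotientAddGroup.mk' (relationsLE 1) (of N) = QuotientAddGroup.mk' (relationsLE 1) (of s) := by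
    rw [← QuotientAddGroup.eq_zero_iff] at h1
    change QuotientAddGroup.mk' (relationsLE 1) _ = 0 at h1
    rwa [map_sub, sub_eq_zero] at h1
  rw [hcls]
  -- the pushed-forward representation: bounded, `K`-rational, pole-free
  have hsub : s.domain ⊆ {w | w 0 ∈ Set.Ioo (-1:ℝ) 1} := by
    rw [hsd]
    rintro _ ⟨p, hp, rfl⟩
    have h := hfar p hp
    show (p 0)⁻¹ ∈ Set.Ioo (-1:ℝ) 1
    have : |(p 0)⁻¹| < 1 := by rw [abs_inv]; exact inv_lt_one_of_one_lt₀ h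
    exact ⟨by linarith [neg_abs_le (p 0)⁻¹], by linarith [le_abs_self (p 0)⁻¹]⟩
  set dP := P.natDegree with hdP
  set dQ := Q.natDegree with hdQ
  set P₂ : (algebraicClosure ℚ ℝ)[X] := Polynomial.reflect dP P * Polynomial.X ^ dQ with hP₂_def
  set Q₂ : (algebraicClosure ℚ ℝ)[X] := Polynomial.reflect dQ Q * Polynomial.X ^ (dP + 2) with hQ₂_def
  have hrefQ : ∀ p ∈ N.domain, (Polynomial.aeval (p 0)⁻¹ (Polynomial.reflect dQ Q) : ℝ) ≠ 0 := by
    intro p hp h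
    apply hQ p hp
    have e := aevalK_inv_eq Q le_rfl (inv_ne_zero (h0 p hp)) (N := dQ)
    rw [inv_inv] at e
    rw [e, h, zero_mul]
  have hQ₂ : ∀ w ∈ s.domain, (Polynomial.aeval (w 0) Q₂ : ℝ) ≠ 0 := by
    rw [hsd]
    rintro _ ⟨p, hp, rfl⟩
    show (Polynomial.aeval (p 0)⁻¹ Q₂ : ℝ) ≠ 0
    rw [hQ₂_def, map_mul, map_pow, Polynomial.aeval_X]
    exact mul_ne_zero (hrefQ p hp) (pow_ne_zero _ (inv_ne_zero (h0 p hp)))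
  have hsi' : EqOn s.integrand (fun w => (Polynomial.aeval (w 0) P₂ : ℝ) / Polynomial.aeval (w 0) Q₂)
      s.domain := by
    rw [hsd]
    rintro _ ⟨p, hp, rfl⟩
    have hx := h0 p hp
    rw [hsi p hp, hNi hp]
    show (Polynomial.aeval (p 0) P : ℝ) / Polynomial.aeval (p 0) Q / |-(p 0 ^ 2)⁻¹| =
      Polynomial.aeval (p 0)⁻¹ P₂ / Polynomial.aeval (p 0)⁻¹ Q₂
    have eP := aevalK_inv_eq P le_rfl (inv_ne_zero hx) (N := dP)
    have eQ := aevalK_inv_eq Q le_rfl (inv_ne_zero hx) (N := dQ)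
    rw [inv_inv] at eP eQ
    rw [hP₂_def, hQ₂_def, map_mul, map_mul, map_pow, map_pow, Polynomial.aeval_X, eP, eQ, abs_neg,
      abs_inv, abs_pow, sq_abs]
    simp only [inv_pow]
    have hrQ := hrefQ p hp
    field_simp
    ring
  exact nfD_of_kRational_bounded hR hZ hRG isAlgebraic_one.neg isAlgebraic_one s hsub P₂ Q₂ hQ₂ hsi'

/-! ## Every real-algebraic rational arc is a mixed normal form -/

/-- **A representation of dimension one with `K`-rational pole-free integrand on its domain is a
mixed normal form** in `FormalRep ⧸ relationsLE 1` (inside the budget `relationsLE 1`): split the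
domain at `x = 1` and `x = −1` (rule 1a in dimension `1`, `Budget.split_mem_relationsLE`); the middle
piece is bounded (`Baker.nfD_of_kRational_bounded`), the two far pieces are inverted
(`nfD_of_kRational_invert`). [cite: KontsevichZagier2001, §1.2 rules (1), (2)] -/
theorem nfD_of_kRational_dim_one
    (hR : ∀ a b c, IsAlgebraic ℚ a → IsAlgebraic ℚ b → IsAlgebraic ℚ c → 0 < a →
      (RA a b c).domain = {x | x 0 ∈ Set.Ioo a b} ∧ (RA a b c).integrand = fun x => c / x 0)
    (hZ : ∀ r, IsAlgebraic ℚ r → (ZA r).domain = univ ∧ (ZA r).integrand = fun _ => r)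
    (hRG : ∀ t d, IsAlgebraic ℚ t → IsAlgebraic ℚ d →
      (RG t d).domain = {x | x 0 ∈ Set.Ioo 0 t} ∧ (RG t d).integrand = fun x => d / (1 + x 0 ^ 2))
    (N : IntegralRep 1) (P Q : (algebraicClosure ℚ ℝ)[X])
    (hQ : ∀ p ∈ N.domain, (Polynomial.aeval (p 0) Q : ℝ) ≠ 0)
    (hNi : EqOn N.integrand (fun x => (Polynomial.aeval (x 0) P : ℝ) / Polynomial.aeval (x 0) Q)
      N.domain) :
    ∃ (r : ℝ) (k : ℕ) (u c : Fin k → ℝ) (k' : ℕ) (t d : Fin k' → ℝ), IsAlgebraic ℚ r ∧ (∀ j, 1 < u j) ∧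
      (∀ j, IsAlgebraic ℚ (u j)) ∧ (∀ j, IsAlgebraic ℚ (c j)) ∧ (∀ l, 0 ≤ t l) ∧
      (∀ l, IsAlgebraic ℚ (t l)) ∧ (∀ l, IsAlgebraic ℚ (d l)) ∧
      QuotientAddGroup.mk' (relationsLE 1) (of N) = QuotientAddGroup.mk' (relationsLE 1) (of (ZA r)) +
        ∑ j, QuotientAddGroup.mk' (relationsLE 1) (of (RA 1 (u j) (c j))) +
        ∑ l, QuotientAddGroup.mk' (relationsLE 1) (of (RG (t l) (d l))) := by
  -- the far-right piece and the rest
  have hA : IsSemialgebraic ℚ {x : Fin 1 → ℝ | 1 < x 0} := isSemialgebraic_setOf_const_lt_apply isAlgebraic_one 0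
  have hB : IsSemialgebraic ℚ {x : Fin 1 → ℝ | x 0 < -1} :=
    isSemialgebraic_setOf_apply_lt_const isAlgebraic_one.neg 0
  set Np := N.restrict (N.domain ∩ {x : Fin 1 → ℝ | 1 < x 0}) (N.isSemialgebraic_domain.inter hA)
    inter_subset_left with hNp
  set Nq := N.restrict (N.domain \ {x : Fin 1 → ℝ | 1 < x 0}) (N.isSemialgebraic_domain.diff hA)
    sdiff_subset with hNq
  set Nm := Nq.restrict (Nq.domain ∩ {x : Fin 1 → ℝ | x 0 < -1}) (Nq.isSemialgebraic_domain.inter hB)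
    inter_subset_left with hNm
  set Nb := Nq.restrict (Nq.domain \ {x : Fin 1 → ℝ | x 0 < -1}) (Nq.isSemialgebraic_domain.diff hB)
    sdiff_subset with hNb
  have h1 : of N - of Np - of Nq ∈ relationsLE 1 := Budget.split_mem_relationsLE le_rfl N _ hA
  have h2 : of Nq - of Nm - of Nb ∈ relationsLE 1 := Budget.split_mem_relationsLE le_rfl Nq _ hB
  have hcls : QuotientAddGroup.mk' (relationsLE 1) (of N) =
      QuotientAddGroup.mk' (relationsLE 1) (of Np) + (QuotientAddGroup.mk' (relationsLE 1) (of Nm) +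
        QuotientAddGroup.mk' (relationsLE 1) (of Nb)) := by
    rw [← QuotientAddGroup.eq_zero_iff] at h1 h2
    change QuotientAddGroup.mk' (relationsLE 1) _ = 0 at h1 h2
    rw [map_sub, map_sub, sub_sub, sub_eq_zero] at h1 h2
    rw [h1, h2]
  rw [hcls]
  refine nfD_add hZ ?_ (nfD_add hZ ?_ ?_)
  · -- `x > 1`: invert
    exact nfD_of_kRational_invert hR hZ hRG Np
      (fun p hp => by rw [abs_of_pos (lt_trans one_pos hp.2)]; exact hp.2) P Q
      (fun p hp => hQ p hp.1) (fun p hp => hNi hp.1)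
  · -- `x < -1`: invert
    refine nfD_of_kRational_invert hR hZ hRG Nm (fun p hp => ?_) P Q
      (fun p hp => hQ p hp.1.1) (fun p hp => hNi hp.1.1)
    have h : p 0 < -1 := hp.2
    rw [abs_of_neg (by linarith)]
    linarith
  · -- `-1 ≤ x ≤ 1`: bounded
    refine nfD_of_kRational_bounded hR hZ hRG (a := -2) (b := 2) ((isAlgebraic_nat (R := ℚ) 2).neg)
      (by exact_mod_cast isAlgebraic_nat (R := ℚ) 2) Nb (fun p hp => ?_) P Q
      (fun p hp => hQ p hp.1.1) (fun p hp => hNi hp.1.1)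
    have ha : ¬ 1 < p 0 := hp.1.2
    have hb : ¬ p 0 < -1 := hp.2
    exact ⟨by linarith [not_lt.mp hb], by linarith [not_lt.mp ha]⟩

/-! ## The `0`-dimensional representations -/

/-- **A `0`-dimensional representation is a mixed normal form** in `FormalRep ⧸ relationsLE 1`
(inside the budget `relationsLE 1`): its domain is empty (a truncated relation, null domain) or the
point, where its value — the value of a `ℚ`-semialgebraic function at the (algebraic) point — is a
real algebraic number (`IsSemialgebraicFunOn.isAlgebraic_apply`), i.e. a point carrier `[pt, r]`
(`Port.Dlog.nfD_pt`). [cite: KontsevichZagier2001, §1.2 rule (1)] -/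
theorem nfD_of_dim_zero
    (hZ : ∀ r, IsAlgebraic ℚ r → (ZA r).domain = univ ∧ (ZA r).integrand = fun _ => r)
    (c : IntegralRep 0) :
    ∃ (r : ℝ) (k : ℕ) (u c' : Fin k → ℝ) (k' : ℕ) (t d : Fin k' → ℝ), IsAlgebraic ℚ r ∧ (∀ j, 1 < u j) ∧
      (∀ j, IsAlgebraic ℚ (u j)) ∧ (∀ j, IsAlgebraic ℚ (c' j)) ∧ (∀ l, 0 ≤ t l) ∧
      (∀ l, IsAlgebraic ℚ (t l)) ∧ (∀ l, IsAlgebraic ℚ (d l)) ∧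
      QuotientAddGroup.mk' (relationsLE 1) (of c) = QuotientAddGroup.mk' (relationsLE 1) (of (ZA r)) +
        ∑ j, QuotientAddGroup.mk' (relationsLE 1) (of (RA 1 (u j) (c' j))) +
        ∑ l, QuotientAddGroup.mk' (relationsLE 1) (of (RG (t l) (d l))) := by
  rcases Set.eq_empty_or_nonempty c.domain with h | ⟨x₀, hx₀⟩
  · have h0 : QuotientAddGroup.mk' (relationsLE 1) (of c) = 0 :=
      (QuotientAddGroup.eq_zero_iff _).mpr
        (Budget.of_mem_relationsLE_of_volume_eq_zero zero_le_one c (by rw [h, measure_empty]))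
    rw [h0]
    exact nfD_zero hZ
  · have hv : IsAlgebraic ℚ (c.integrand x₀) :=
      c.isSemialgebraicFunOn_integrand.isAlgebraic_apply hx₀ fun i => i.elim0
    refine nfD_pt hZ hv c (Set.eq_univ_of_forall fun x => by rwa [Subsingleton.elim x x₀]) ?_
    funext x
    rw [Subsingleton.elim x x₀]

end Baker

/-! ## The registered stub -/

open Summit.KontsevichZagierPeriods.HurwitzMicroSectors.NormalFormPrinciple.PiBox.Dlog
  (exists_carrierA exists_ptCarrierA exists_angCarrier) in
open Summit.KontsevichZagierPeriods.AbelContraction.RealHyperellipticSector.Port.Dlog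
  (nfD_zero nfD_add nfD_neg nfD_eq_zero_of_eval_eq_zero) in
/-- **Registered stub `stub_bakerAlg` of crux stmt-KontsevichZagierPeriods-12475** (line
`Lines/birth.lean`, route AbelContraction): every value-`0` element of the subgroup of
`KZ.FormalRep` generated by the real-algebraic rational arcs `algArcs` and the `0`-dimensional
representations `consts` is a TRUNCATED Kontsevich–Zagier relation of `KZ.relationsLE 1` — every
move among representations of dimension `≤ 1` (rules (1a), (1b), (2) in dimension `1` or `0`,
Newton–Leibniz `1 → 0`). Proof: every generator is a mixed normal form
`[pt, r] + Σ Λ(uⱼ, cⱼ) + Σ T(t_l, d_l)` in `FormalRep ⧸ relationsLE 1`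
(`Baker.nfD_of_kRational_dim_one`, `Baker.nfD_of_dim_zero`), mixed normal forms are closed under
`+` and `−`, and a value-`0` mixed normal form is the zero class by Baker's theorem for logarithms
and angles (`Port.Dlog.nfD_eq_zero_of_eval_eq_zero`). [cite: KontsevichZagier2001, §1.2 Conjecture 1]
[cite: Baker1975, Thm 2.1] -/
theorem stub_bakerAlg : ∀ x ∈ AddSubgroup.closure (algArcs ∪ consts), KZ.eval x = 0 → x ∈ KZ.relationsLE 1 := by
  intro x hx
  classical
  obtain ⟨RA, hR⟩ := exists_carrierA
  obtain ⟨ZA, hZ⟩ := exists_ptCarrierA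
  obtain ⟨RG, hRG⟩ := exists_angCarrier
  -- every element of the subgroup is a mixed normal form inside the budget
  have key : ∃ (r : ℝ) (k : ℕ) (u c : Fin k → ℝ) (k' : ℕ) (t d : Fin k' → ℝ), IsAlgebraic ℚ r ∧
      (∀ j, 1 < u j) ∧ (∀ j, IsAlgebraic ℚ (u j)) ∧ (∀ j, IsAlgebraic ℚ (c j)) ∧ (∀ l, 0 ≤ t l) ∧
      (∀ l, IsAlgebraic ℚ (t l)) ∧ (∀ l, IsAlgebraic ℚ (d l)) ∧
      QuotientAddGroup.mk' (relationsLE 1) x = QuotientAddGroup.mk' (relationsLE 1) (of (ZA r)) +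
        ∑ j, QuotientAddGroup.mk' (relationsLE 1) (of (RA 1 (u j) (c j))) +
        ∑ l, QuotientAddGroup.mk' (relationsLE 1) (of (RG (t l) (d l))) := by
    induction hx using AddSubgroup.closure_induction with
    | mem y hy =>
      rcases hy with hy | hy
      · obtain ⟨r, P, Q, S, -, -, -, hQ, hEq, rfl⟩ := hy
        exact Baker.nfD_of_kRational_dim_one hR hZ hRG r P Q hQ hEq
      · obtain ⟨c, rfl⟩ := hy
        exact Baker.nfD_of_dim_zero hZ c
    | zero => rw [map_zero]; exact nfD_zero hZ
    | add y z _ _ ihy ihz => rw [map_add]; exact nfD_add hZ ihy ihz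
    | neg y _ ih => rw [map_neg]; exact nfD_neg hR hZ hRG ih
  intro hv
  obtain ⟨r, k, u, c, k', t, d, hr, hu1, hu, hc, ht0, ht, hd, hEq⟩ := key
  exact (QuotientAddGroup.eq_zero_iff _).mp
    (nfD_eq_zero_of_eval_eq_zero hR hZ hRG x hr hu1 hu hc ht0 ht hd hEq hv)

end Summit.KontsevichZagierPeriods.AbelContraction.RealHyperellipticSector

end
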